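import Literature.AnabelianGeometry.AbsoluteAnabelian.DiagramLifts

/-!
# The universal family of homotopies on the pairs factoring through fully faithful vertices
# ([AbsTopIII] Def. 3.5 (ii)–(iv), toolkit II)

S. Mochizuki, *Topics in Absolute Anabelian Geometry III*, Def. 3.5 (ii)–(iv) pp. 75–76 (manuscript
`paper:url-5493eb38cbb7`, bib key `MochizukiAbsTopIII2015`).  Continuation of `DiagramLifts.lean`:
given structure functors `(N, μ)` (`OverData`) on a diagram of categories `𝒟` and a set `W` of
vertices at which `N_w` is fully faithful, the set `E_W` of co-verticial pairs
`([σ]∘[γ₁], [σ]∘[γ₂])` — `[γ₁], [γ₂]` co-verticial into some `w ∈ W`, `[σ]` a common suffix out of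
`w` (Def. 3.5 (iv) (b) is the case `W = {v_𝒮}`) — is saturated, and whiskering the lifts of
`DiagramLifts` along the suffixes gives a well-defined family of homotopies on `E_W`
(`univFamily`), the **universal family**: its homotopy on a pair into `w ∈ W` is the lift
(`univFamily_η_eq_lift`).  Restricting it (`HomotopyFamily.restrictBoundary`) to `W = {v_𝒮}`-pairs
gives telecore families `𝒥`, and to the saturation of chosen generators gives contact structures,
automatically compatible with each other (Def. 3.5 (iv)).  Special cases in the tree: `coreFamily`
(`DiagramCores`, `W = {v_𝒮}`, `N_{v_𝒮} = 𝟭`), seat abc-iut-L4-t12's `teleK` (all vertices, strict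
structure functors).  Pure category theory; no claim of the paper is asserted.  Consumer:
`AbsTopIII/FrobeniusPictureMLFTelecoreProofs.lean` (Cor. 3.6 (ii) = Cor. 4.5 (ii) discharged).
-/

namespace Literature.AnabelianGeometry.AbsoluteAnabelian

open _root_.CategoryTheory _root_.Quiver

universe v u w

namespace DiagramOfCategories

variable {V : Type w} [Quiver.{v} V] {D : DiagramOfCategories.{v, u, w} V}

/-! ### Decompositions through `W` and the boundary set `E_W` -/

/-- A **decomposition through `W`** of a co-verticial pair `(P, Q)`: `P = [σ]∘[γ₁]`, `Q = [σ]∘[γ₂]`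
with `[γ₁], [γ₂]` co-verticial into a vertex `w ∈ W` and a common suffix `[σ]` out of `w` (Def. 3.5
(iv) (b) is the case `W = {v_𝒮}`: "the subset of pairs of paths … of the form
`([γ₃]∘[γ₁], [γ₃]∘[γ₂])`"). [cite: MochizukiAbsTopIII2015, Definition 3.5 (iv) p.76] -/
structure Decomp (W : V → Prop) {a b : V} (P Q : Path a b) : Type (max v w) where
  /-- the intermediate vertex -/
  w : V
  mem : W w
  /-- the left prefix `[γ₁]` -/
  p : Path a w
  /-- the right prefix `[γ₂]` -/
  q : Path a w
  /-- the common suffix `[σ]` -/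
  s : Path w b
  left_eq : P = p.comp s
  right_eq : Q = q.comp s

/-- The boundary set `E_W`: pairs admitting a decomposition through `W`.
[cite: MochizukiAbsTopIII2015, Definition 3.5 (iv) p.76] -/
def univE (W : V → Prop) : ∀ ⦃a b : V⦄, Path a b → Path a b → Prop :=
  fun _ _ P Q => Nonempty (Decomp W P Q)

/-- `E_W` is saturated (§0 p. 26 (a)–(e); transitivity by nestedness of suffix decompositions).
[cite: MochizukiAbsTopIII2015, Section 0 p.26] -/
theorem isSaturated_univE (W : V → Prop) : IsSaturated (univE (V := V) W) where
  refl_left _ _ _ _ := fun ⟨d⟩ => ⟨⟨d.w, d.mem, d.p, d.p, d.s, d.left_eq, d.left_eq⟩⟩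
  refl_right _ _ _ _ := fun ⟨d⟩ => ⟨⟨d.w, d.mem, d.q, d.q, d.s, d.right_eq, d.right_eq⟩⟩
  trans _ _ _ _ _ := fun ⟨d⟩ ⟨d'⟩ => by
    rcases path_suffix_nested d.s d'.s d.q d'.p (d.right_eq.symm.trans d'.left_eq) with
      ⟨t, ht⟩ | ⟨t, ht⟩
    · exact ⟨⟨d'.w, d'.mem, d.p.comp t, d'.q, d'.s, by rw [Path.comp_assoc, ← ht]; exact d.left_eq,
        d'.right_eq⟩⟩
    · exact ⟨⟨d.w, d.mem, d.p, d'.q.comp t, d.s, d.left_eq,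
        by rw [Path.comp_assoc, ← ht]; exact d'.right_eq⟩⟩
  precomp _ _ _ _ _ := fun ⟨d⟩ r =>
    ⟨⟨d.w, d.mem, r.comp d.p, r.comp d.q, d.s, by rw [Path.comp_assoc, ← d.left_eq],
      by rw [Path.comp_assoc, ← d.right_eq]⟩⟩
  postcomp _ _ _ _ _ := fun ⟨d⟩ r =>
    ⟨⟨d.w, d.mem, d.p, d.q, d.s.comp r, by rw [← Path.comp_assoc, ← d.left_eq],
      by rw [← Path.comp_assoc, ← d.right_eq]⟩⟩

/-- A pair of co-verticial paths into `w ∈ W` lies in `E_W` (trivial suffix).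
[cite: MochizukiAbsTopIII2015, Definition 3.5 (iv) p.76] -/
theorem univE_of_mem (W : V → Prop) {a w : V} (hw : W w) (p q : Path a w) : univE W p q :=
  ⟨⟨w, hw, p, q, Path.nil, rfl, rfl⟩⟩

/-- `E_W` grows with `W`. [cite: MochizukiAbsTopIII2015, Definition 3.5 (iv) p.76] -/
theorem univE_mono {W W' : V → Prop} (h : ∀ w, W w → W' w) {a b : V} {P Q : Path a b}
    (hPQ : univE W P Q) : univE W' P Q :=
  let ⟨d⟩ := hPQ; ⟨⟨d.w, h _ d.mem, d.p, d.q, d.s, d.left_eq, d.right_eq⟩⟩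

/-! ### The homotopy of a decomposition; well-definedness -/

section Universal

variable {C : Type u} [Category.{v} C] (O : D.OverData C) (W : V → Prop)
  (hW : ∀ w, W w → (O.N w).FullyFaithful)

/-- The path functors of a decomposed pair factor: `𝒟_[P] = 𝒟_[σ] ∘ 𝒟_[γ₁]` (Def. 3.5 (i)).
[cite: MochizukiAbsTopIII2015, Definition 3.5 (i) p.75] -/
theorem Decomp.pathFunctor_left {a b : V} {P Q : Path a b} (d : Decomp W P Q) :
    D.pathFunctor P = D.pathFunctor d.p ⋙ D.pathFunctor d.s := by
  rw [← pathFunctor_comp, ← d.left_eq]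

/-- `𝒟_[Q] = 𝒟_[σ] ∘ 𝒟_[γ₂]` (Def. 3.5 (i)). [cite: MochizukiAbsTopIII2015, Definition 3.5 (i) p.75] -/
theorem Decomp.pathFunctor_right {a b : V} {P Q : Path a b} (d : Decomp W P Q) :
    D.pathFunctor Q = D.pathFunctor d.q ⋙ D.pathFunctor d.s := by
  rw [← pathFunctor_comp, ← d.right_eq]

/-- The homotopy attached to a decomposition: the lift at `w`, whiskered by the common suffix —
`ζ = lift γ₁ γ₂ ▷ 𝒟_[σ]` (Def. 3.5 (ii) whiskering; Def. 3.5 (iv) (b)).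
[cite: MochizukiAbsTopIII2015, Definition 3.5 (iv) p.76] -/
noncomputable def Decomp.η {a b : V} {P Q : Path a b} (d : Decomp W P Q) :
    D.pathFunctor P ⟶ D.pathFunctor Q :=
  eqToHom (d.pathFunctor_left W) ≫
    Functor.whiskerRight (O.lift (hW d.w d.mem) d.p d.q) (D.pathFunctor d.s) ≫
      eqToHom (d.pathFunctor_right W).symm

/-- `Decomp.η` is, heterogeneously, the whiskered lift. [folklore] -/
private theorem Decomp.η_heq {a b : V} {P Q : Path a b} (d : Decomp W P Q) :
    d.η O W hW ≍ Functor.whiskerRight (O.lift (hW d.w d.mem) d.p d.q) (D.pathFunctor d.s) :=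
  (conj_eqToHom_iff_heq _ _ (d.pathFunctor_left W) (d.pathFunctor_right W)).mp rfl

/-- Whiskering on the right respects heterogeneous equality (bookkeeping). [folklore] -/
private theorem whiskerRight_heq {A B B' : Type u} [Category.{v} A] [Category.{v} B]
    [Category.{v} B'] {F G F' G' : A ⥤ B} (hF : F = F') (hG : G = G') {α : F ⟶ G} {α' : F' ⟶ G'}
    (h : α ≍ α') {T T' : B ⥤ B'} (hT : T = T') :
    Functor.whiskerRight α T ≍ Functor.whiskerRight α' T' := by
  subst hF hG hT
  cases h
  rfl

/-- Whiskering on the left respects heterogeneous equality (bookkeeping). [folklore] -/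
private theorem whiskerLeft_heq {A A' B : Type u} [Category.{v} A] [Category.{v} A']
    [Category.{v} B] (R : A' ⥤ A) {F G F' G' : A ⥤ B} (hF : F = F') (hG : G = G') {α : F ⟶ G}
    {α' : F' ⟶ G'} (h : α ≍ α') : Functor.whiskerLeft R α ≍ Functor.whiskerLeft R α' := by
  subst hF hG
  cases h
  rfl

/-- Iterated right whiskering is right whiskering by the composite. [folklore] -/
private theorem whiskerRight_whiskerRight {A B B' B'' : Type u} [Category.{v} A] [Category.{v} B]
    [Category.{v} B'] [Category.{v} B''] {F G : A ⥤ B} (α : F ⟶ G) (T : B ⥤ B') (S : B' ⥤ B'') :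
    Functor.whiskerRight (Functor.whiskerRight α T) S = Functor.whiskerRight α (T ⋙ S) :=
  NatTrans.ext (funext fun _ => rfl)

/-- Right whiskering by the identity functor does nothing (the composites `F ⋙ 𝟭` and `F` agree
definitionally). [folklore] -/
private theorem whiskerRight_id_functor {A B : Type u} [Category.{v} A] [Category.{v} B]
    {F G : A ⥤ B} (α : F ⟶ G) : Functor.whiskerRight α (𝟭 B) = α :=
  NatTrans.ext (funext fun _ => rfl)

/-- `(R ◁ α) ▷ S = R ◁ (α ▷ S)`. [folklore] -/
private theorem whiskerRight_whiskerLeft {A A' B B' : Type u} [Category.{v} A] [Category.{v} A']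
    [Category.{v} B] [Category.{v} B'] (R : A' ⥤ A) {F G : A ⥤ B} (α : F ⟶ G) (S : B ⥤ B') :
    Functor.whiskerRight (Functor.whiskerLeft R α) S =
      Functor.whiskerLeft R (Functor.whiskerRight α S) :=
  NatTrans.ext (funext fun _ => rfl)

/-- Nested decompositions give the same homotopy (case `σ = τ∘σ'`). [folklore] -/
private theorem Decomp.η_eq_of_suffix {a b : V} {P Q : Path a b} (d d' : Decomp W P Q)
    (t : Path d.w d'.w) (ht : d.s = t.comp d'.s) : d.η O W hW = d'.η O W hW := by
  obtain ⟨w, m, p, q, s, hP, hQ⟩ := d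
  obtain ⟨w', m', p', q', s', hP', hQ'⟩ := d'
  dsimp only at t ht
  subst ht
  obtain rfl : p.comp t = p' := Path.comp_injective_left s'
    (show (p.comp t).comp s' = p'.comp s' by rw [Path.comp_assoc]; exact hP.symm.trans hP')
  obtain rfl : q.comp t = q' := Path.comp_injective_left s'
    (show (q.comp t).comp s' = q'.comp s' by rw [Path.comp_assoc]; exact hQ.symm.trans hQ')
  refine eq_of_heq ((Decomp.η_heq O W hW _).trans (HEq.trans ?_ (Decomp.η_heq O W hW _).symm))
  dsimp only
  refine (whiskerRight_heq rfl rfl HEq.rfl (D.pathFunctor_comp t s')).trans ?_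
  rw [← whiskerRight_whiskerRight]
  exact whiskerRight_heq (D.pathFunctor_comp p t).symm (D.pathFunctor_comp q t).symm
    (O.lift_postcomp_heq (hW w m) (hW w' m') p q t).symm rfl

/-- **Well-definedness**: any two decompositions through `W` of the same pair give the same
homotopy (so the telecore/contact homotopies do not depend on the chosen factorisation
`([γ₃]∘[γ₁], [γ₃]∘[γ₂])` of Def. 3.5 (iv) (b)). [cite: MochizukiAbsTopIII2015, Definition 3.5 (iv) p.76] -/
theorem Decomp.η_eq {a b : V} {P Q : Path a b} (d d' : Decomp W P Q) :
    d.η O W hW = d'.η O W hW := by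
  rcases path_suffix_nested d.s d'.s d.p d'.p (d.left_eq.symm.trans d'.left_eq) with
    ⟨t, ht⟩ | ⟨t, ht⟩
  · exact Decomp.η_eq_of_suffix O W hW d d' t ht
  · exact (Decomp.η_eq_of_suffix O W hW d' d t ht).symm

/-- The homotopy of the trivial decomposition (`σ` empty) is the lift itself.
[cite: MochizukiAbsTopIII2015, Definition 3.5 (ii) p.75] -/
theorem Decomp.η_nil {a w : V} (hw : W w) (p q : Path a w) :
    (⟨w, hw, p, q, Path.nil, rfl, rfl⟩ : Decomp W p q).η O W hW = O.lift (hW w hw) p q := by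
  refine eq_of_heq ((Decomp.η_heq O W hW _).trans ?_)
  change Functor.whiskerRight (O.lift (hW w hw) p q) (D.pathFunctor Path.nil) ≍ _
  rw [pathFunctor_nil]
  exact heq_of_eq (whiskerRight_id_functor _)

/-- Transitivity of the decomposition homotopies along a common suffix. [folklore] -/
private theorem Decomp.η_trans_aux {a b w : V} (hw : W w) (p q r : Path a w) (s : Path w b)
    {P Q R : Path a b} (hP : P = p.comp s) (hQ : Q = q.comp s) (hR : R = r.comp s) :
    (⟨w, hw, p, q, s, hP, hQ⟩ : Decomp W P Q).η O W hW ≫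
        (⟨w, hw, q, r, s, hQ, hR⟩ : Decomp W Q R).η O W hW =
      (⟨w, hw, p, r, s, hP, hR⟩ : Decomp W P R).η O W hW := by
  simp only [Decomp.η, Category.assoc, eqToHom_trans_assoc, eqToHom_refl, Category.id_comp]
  rw [← Category.assoc (Functor.whiskerRight _ _), ← Functor.whiskerRight_comp, O.lift_trans]

/-! ### The universal family -/

/-- **The universal family of homotopies** determined by structure functors fully faithful on
`W`: boundary set `E_W`, homotopy of `([σ]∘[γ₁], [σ]∘[γ₂])` = `lift γ₁ γ₂ ▷ 𝒟_[σ]`; it satisfies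
the axioms (identity, composition, whiskering) of a family of homotopies, Def. 3.5 (ii).
[cite: MochizukiAbsTopIII2015, Definition 3.5 (ii) p.75] -/
noncomputable def univFamily : D.HomotopyFamily where
  E := univE W
  isSaturated := isSaturated_univE W
  η := fun _ _ _ _ h => (Classical.choice h).η O W hW
  η_refl := by
    intro a b P h
    let d := Classical.choice h
    show Decomp.η O W hW (Classical.choice h) = _
    rw [Decomp.η_eq O W hW (Classical.choice h) ⟨d.w, d.mem, d.p, d.p, d.s, d.left_eq, d.left_eq⟩]
    simp only [Decomp.η, O.lift_self, Functor.whiskerRight_id', Category.id_comp, eqToHom_trans,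
      eqToHom_refl]
  η_trans := by
    intro a b P Q R h₁ h₂
    let d₁ := Classical.choice h₁
    let d₂ := Classical.choice h₂
    show Decomp.η O W hW (Classical.choice _) =
      Decomp.η O W hW (Classical.choice h₁) ≫ Decomp.η O W hW (Classical.choice h₂)
    rcases path_suffix_nested d₁.s d₂.s d₁.q d₂.p (d₁.right_eq.symm.trans d₂.left_eq) with
      ⟨t, ht⟩ | ⟨t, ht⟩
    · -- `σ₁ = τ ∘ σ₂`: re-decompose everything through `w₂`
      have hp₂ : d₁.q.comp t = d₂.p := Path.comp_injective_left d₂.s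
        (show (d₁.q.comp t).comp d₂.s = d₂.p.comp d₂.s by
          rw [Path.comp_assoc, ← ht]; exact d₁.right_eq.symm.trans d₂.left_eq)
      have hP : P = (d₁.p.comp t).comp d₂.s := by rw [Path.comp_assoc, ← ht]; exact d₁.left_eq
      have hQ : Q = (d₁.q.comp t).comp d₂.s := by rw [hp₂]; exact d₂.left_eq
      rw [Decomp.η_eq O W hW (Classical.choice _)
          ⟨d₂.w, d₂.mem, d₁.p.comp t, d₂.q, d₂.s, hP, d₂.right_eq⟩,
        Decomp.η_eq O W hW (Classical.choice h₁)
          ⟨d₂.w, d₂.mem, d₁.p.comp t, d₁.q.comp t, d₂.s, hP, hQ⟩,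
        Decomp.η_eq O W hW (Classical.choice h₂)
          ⟨d₂.w, d₂.mem, d₁.q.comp t, d₂.q, d₂.s, hQ, d₂.right_eq⟩,
        Decomp.η_trans_aux]
    · -- `σ₂ = τ ∘ σ₁`: re-decompose everything through `w₁`
      have hq₁ : d₂.p.comp t = d₁.q := Path.comp_injective_left d₁.s
        (show (d₂.p.comp t).comp d₁.s = d₁.q.comp d₁.s by
          rw [Path.comp_assoc, ← ht]; exact d₂.left_eq.symm.trans d₁.right_eq)
      have hR : R = (d₂.q.comp t).comp d₁.s := by rw [Path.comp_assoc, ← ht]; exact d₂.right_eq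
      have hQ : Q = (d₂.p.comp t).comp d₁.s := by rw [hq₁]; exact d₁.right_eq
      rw [Decomp.η_eq O W hW (Classical.choice _)
          ⟨d₁.w, d₁.mem, d₁.p, d₂.q.comp t, d₁.s, d₁.left_eq, hR⟩,
        Decomp.η_eq O W hW (Classical.choice h₁)
          ⟨d₁.w, d₁.mem, d₁.p, d₂.p.comp t, d₁.s, d₁.left_eq, hQ⟩,
        Decomp.η_eq O W hW (Classical.choice h₂)
          ⟨d₁.w, d₁.mem, d₂.p.comp t, d₂.q.comp t, d₁.s, hQ, hR⟩,
        Decomp.η_trans_aux]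
  η_whisker := by
    intro a b c e P Q h r₁ r₂
    let d := Classical.choice h
    have hP : r₁.comp (P.comp r₂) = (r₁.comp d.p).comp (d.s.comp r₂) := by
      rw [Path.comp_assoc, ← Path.comp_assoc d.p d.s r₂, ← d.left_eq]
    have hQ : r₁.comp (Q.comp r₂) = (r₁.comp d.q).comp (d.s.comp r₂) := by
      rw [Path.comp_assoc, ← Path.comp_assoc d.q d.s r₂, ← d.right_eq]
    show Decomp.η O W hW (Classical.choice _) = eqToHom _ ≫ Functor.whiskerLeft (D.pathFunctor r₁)
      (Functor.whiskerRight (Decomp.η O W hW (Classical.choice h)) (D.pathFunctor r₂)) ≫ eqToHom _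
    rw [Decomp.η_eq O W hW (Classical.choice _)
      ⟨d.w, d.mem, r₁.comp d.p, r₁.comp d.q, d.s.comp r₂, hP, hQ⟩]
    refine (conj_eqToHom_iff_heq' _ _ _ _).mpr ((Decomp.η_heq O W hW _).trans ?_)
    dsimp only
    -- both sides are `𝒟_[ρ₁] ◁ lift γ₁ γ₂ ▷ (𝒟_[σ] ⋙ 𝒟_[ρ₂])` up to the path-functor identities
    have h1 : Functor.whiskerRight (O.lift (hW d.w d.mem) (r₁.comp d.p) (r₁.comp d.q))
        (D.pathFunctor (d.s.comp r₂)) ≍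
        Functor.whiskerRight (Functor.whiskerLeft (D.pathFunctor r₁) (O.lift (hW d.w d.mem) d.p d.q))
          (D.pathFunctor d.s ⋙ D.pathFunctor r₂) :=
      whiskerRight_heq (D.pathFunctor_comp r₁ d.p) (D.pathFunctor_comp r₁ d.q)
        (O.lift_precomp_heq (hW d.w d.mem) r₁ d.p d.q) (D.pathFunctor_comp d.s r₂)
    have h2 : Functor.whiskerLeft (D.pathFunctor r₁)
        (Functor.whiskerRight (Decomp.η O W hW (Classical.choice h)) (D.pathFunctor r₂)) ≍
        Functor.whiskerLeft (D.pathFunctor r₁) (Functor.whiskerRight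
          (Functor.whiskerRight (O.lift (hW d.w d.mem) d.p d.q) (D.pathFunctor d.s))
          (D.pathFunctor r₂)) :=
      whiskerLeft_heq (D.pathFunctor r₁)
        (congrArg (· ⋙ D.pathFunctor r₂) (d.pathFunctor_left W))
        (congrArg (· ⋙ D.pathFunctor r₂) (d.pathFunctor_right W))
        (whiskerRight_heq (d.pathFunctor_left W) (d.pathFunctor_right W)
          (Decomp.η_heq O W hW d) rfl)
    refine h1.trans (HEq.trans (heq_of_eq ?_) h2.symm)
    rw [whiskerRight_whiskerRight, whiskerRight_whiskerLeft]
    rfl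

/-- The boundary set of the universal family is `E_W`. [cite: MochizukiAbsTopIII2015, Definition 3.5 (ii) p.75] -/
theorem univFamily_E {a b : V} (P Q : Path a b) : (univFamily O W hW).E P Q ↔ univE W P Q := Iff.rfl

/-- The homotopies of the universal family are computed by ANY decomposition.
[cite: MochizukiAbsTopIII2015, Definition 3.5 (ii) p.75] -/
theorem univFamily_η_eq {a b : V} {P Q : Path a b} (h : (univFamily O W hW).E P Q)
    (d : Decomp W P Q) : (univFamily O W hW).η h = d.η O W hW :=
  Decomp.η_eq O W hW _ d

/-- On a co-verticial pair INTO a vertex `w ∈ W` the universal homotopy is the lift at `w`.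
[cite: MochizukiAbsTopIII2015, Definition 3.5 (ii) p.75] -/
theorem univFamily_η_eq_lift {a w : V} (hw : W w) (p q : Path a w) (h : (univFamily O W hW).E p q) :
    (univFamily O W hW).η h = O.lift (hW w hw) p q :=
  (univFamily_η_eq O W hW h ⟨w, hw, p, q, Path.nil, rfl, rfl⟩).trans (Decomp.η_nil O W hW hw p q)

end Universal

end DiagramOfCategories

end Literature.AnabelianGeometry.AbsoluteAnabelian
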